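import Literature.MathematicalPhysics.QuantumFieldTheory.Balaban1983to89.B5Eq129FreeResolventWeightedGradientRow
import Literature.MathematicalPhysics.QuantumFieldTheory.Balaban1983to89.B5Eq129CycleWeightedMass
import Literature.MathematicalPhysics.QuantumFieldTheory.Balaban1983to89.B5Eq129CycleKernelRootLetters

/-!
# `Balaban1983to89.B5Eq129FreeResolventWeightedGradientRowCosh` — T. Bałaban, *Propagators and renormalization transformations for lattice gauge
# theories. I*, Commun. Math. Phys. **95** (1984) 17–40 [Balaban1984PropagatorsI] (1.29) p. 23, p. 36 (exponential weights), serving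
# [Balaban1985BackgroundPropagators] Thm 3.1 (3.42) p. 397 (the `|∇G|` line WITH the decay weight `e^{−δ₀d(y,y′)}`, flat case): **THE ∇-ROW OF THE FREE MASSIVE
# RESOLVENT KERNEL IN THE OWNER's PRODUCT-`cosh` CURRENCY, FOR EVERY CENTRE — `Σ_x W_c(x)·|k(x − e_ν) − k(x)| ≤ W_c(0)·[(1 + e^a)G(0) + 2 sinh a·Σ_{1≤j<⌊N_ν∕2⌋} e^{aj}G(j)]`,
# `W_c(y) = Π_μ cosh(a·dist(c_μ − y_μ, N_μℤ))` the weight of `B5Eq129CoshSupersolution`, `G` the cycle kernel at the shifted mass `m − 2(d−1)t²(cosh a − 1)`; and,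
# for a centre ON the source slice (`c_ν = 0`), the sharper bracket `(1 + cosh a)G(0) + 2 sinh a·Σ sinh(aj)G(j)`** — the JUNCTION of the abstract weighted ∇-row
# `B5Eq129FreeResolventWeightedGradientRow` ((W-0)∕(W-1)) with the one-factor letters `B5Eq129CoshWeightFactorLetters` and the product-weight letters of
# `B5Eq129FreeResolventWeightedMarginal` §3: t4-ne9-idea-1 g129's (W-1′) `weighted_grad_row_le_torus_cosh_offslice` and (W-0) `weighted_grad_row_le_torus_cosh`
# (Mathlib-only scratch under FREEZE (0); credit theirs) in the tree's (FS) encoding with UNEQUAL periods — the storey-J (K∇) letter WITH WEIGHTS (P-J-1b) of the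
# pub-balaban NE9 chain (row L13 of `t4/ROUTES-NE9.md`) in the currency its consumer reads

statement-level skeleton of published theorems with citation tags; proofs where landed; nothing here is a claim about the Yang–Mills mass gap

CITATION HEADER (lean-in-tree rule).  Audit cell `pub-balaban`, sub-cell `t4`, BINDER row NE9; filed by NE9 crux-team LEAF PROVER 05
(`b2b-balaban-t4-ne9-formalise-leaf-05`, gen 81).  OBJECT: [Balaban1984PropagatorsI] (1.29) p. 23's free stencil in the (FS) encoding (`Tor N`, `unitVec`; the resolvent
equation and the shifted-mass cycle solution as HYPOTHESES) and the p. 36 weight EXACTLY as written out in the OWNER's `B5Eq129CoshSupersolution`; no `def`.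
CONTENT: [folklore] composition BY NAME.  Mathematics: t4-ne9-idea-1 g129 (credit).  Nothing of print is asserted.

WHAT IS PROVED (sorry-free; proof lane — 0 `def`).
* **`sum_weight_mul_abs_sub_le`** — EVERY centre `c`: the displayed inequality with the `exp` bracket ((W-1′): the ν-factor is moved to the source by
  `cosh_factor_le_exp_mul_centre`, the transverse product is (W-1)'s `Φ` by `prod_weight_transverse_defect` ∕ `cosh_factor_step`).
* **`sum_weight_mul_abs_sub_le_of_centre_on_slice`** — `c ν = 0`: the `cosh` bracket ((W-0) verbatim: the ν-factor IS the longitudinal weight, `cosh_factor_centre_zero`).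
* §3 **`sum_weight_mul_abs_sub_le_uniform`** ∕ **`…_of_centre_on_slice_uniform`** — UNIFORMLY IN THE PERIODS, in the OWNER's rate window `λ = m − 2d·t²(cosh a − 1) > 0`:
  `Σ_x W_c(x)·|k(x − e_ν) − k(x)| ≤ W_c(0)·[(1 + e^{−a})·G(0) + 2 sinh a ∕ λ]` (every centre) and `… ≤ W_c(0)·[(1 + e^{−a})·G(0) + sinh a ∕ λ]` (`c ν = 0`), by
  `B5Eq129CycleWeightedMass.exp_bracket_le_uniform` ∕ `cosh_bracket_le_uniform` (the V-fold and the `cosh`-weighted mass of the cycle kernel; `G ≥ 0` by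
  `B5Eq129FreeResolventCycleComparison.cycle_solution_nonneg`, `G` even by `B5Eq129FreeResolventCycleProfile.cycle_eq_of_resolvent_eq`).
* §4 **`cycle_apply_zero_eq`** — the one kernel letter in closed form: `G(0) = (1 + qⁿ)∕((1 − qⁿ)√(μ² + 4μt²))` (`q ∈ (0,1)`, `q + q⁻¹ = 2 + μ∕t²`; (B)
  `cycle_profile_eq` + `root_const_eq`); **`sum_weight_mul_abs_sub_le_closedForm`** — every centre, every period: the right side
  `W_c(0)·[(1 + e^{−a})(1 + q^{N_ν})∕((1 − q^{N_ν})√(μ² + 4μt²)) + 2 sinh a ∕ λ]` with NO kernel letter left (`μ = m − 2(d−1)t²(cosh a − 1)`, `λ = m − 2d·t²(cosh a − 1)`);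
  **`cycle_apply_zero_le`** — `G(0) ≤ (1 + 2t∕(n√μ))∕√(μ² + 4μt²)` (`t > 0`; by `B5Eq129CycleKernelRootLetters.closedForm_apply_zero_le`), hence
  **`sum_weight_mul_abs_sub_le_explicit`** — the right side `W_c(0)·[(1 + e^{−a})(1 + 2t∕(N_ν√μ))∕√(μ² + 4μt²) + 2 sinh a ∕ λ]` with NEITHER `G` NOR `q` (both
  discharged inside the proof by (B) `exists_root` ∕ `closedForm_resolvent`): hypotheses = the resolvent equation of `k`, `m > 0`, `t > 0`, `a ≥ 0`, the OWNER's
  window, `N_ν ≥ 2`; in the units `t = η⁻¹`: `(1 + 2∕(N_νη√μ))·η∕√(4μ + μ²η²)` — height-free, with the finite-period factor `1 + 2∕(L_ν√μ)`, `L_ν = N_νη`;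
  **`sum_weight_mul_abs_sub_le_of_centre_on_slice_explicit`** — the same for a centre ON the source slice (`c ν = 0`) with `sinh a∕λ` in place of `2 sinh a∕λ`
  (the case of a weight centred at the OUTPUT site of the Green's function, `B5Eq129FreeResolventWeightedGradientRowOperator`).
HONEST SCOPE.  FLAT (`U = 1`) stencil; `G(0)` stays displayed (closed form `B5Eq129FreeResolventCycleProfile.cycle_profile_eq` at the shifted mass:
`G(0) = (1 + qⁿ)∕((1 − qⁿ)√(μ² + 4μt²))`, `n = N_ν`, `μ = m − 2(d−1)t²(cosh a − 1)`; N23's `S^{cosh}`∕`S^{ctr}` are sharper `n → ∞` evaluations of the UNFOLDED brackets and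
are NOT claimed here).  ONE letter of ONE un-opened storey (J) of row L13; NOT the ∇-line of (3.42) for `G′_k(U)`, NOT
Tier P, NOT NE9 (cell pub-balaban: NE9 NOT PRINTED ∕ NOT PROVED; «NE9 ⇐ the named binders»; row WALLED ON A MODEL (O-NE9-1; #5 UNRULED); spine PROVED 0∕9; rung
(B)+1 finite T⁴ — NOT infinite volume, NOT mass gap, NOT BetaPertH, NOT Clay).  HONEST DEPENDENCY: continuum YM on T⁴ ⇐ BetaPertH ∧ nine spine estimates (0/9
proved); BetaPertH ⇐ (D1) ∧ (D4) ∧ CAP+tail; G-an2-4 gates asym, D1 and NE2/3/4.  NEW file importing `B5Eq129FreeResolventWeightedGradientRow`,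
`B5Eq129CycleWeightedMass` and `B5Eq129CycleKernelRootLetters` only; nothing modified.  Net new unproved facts: 0.
-/

noncomputable section

open scoped BigOperators

namespace Literature.MathematicalPhysics.QuantumFieldTheory.Balaban1983to89.B5Eq129FreeResolventWeightedGradientRowCosh

open B5Prop11Plancherel (Tor unitVec)
open B4TorusKernel.MultiPeriod (circAbs)
open B5Eq129FreeResolventWeightedMarginal (prod_weight_transverse_defect prod_weight_add_unitVec prod_weight_reflect)
open B5Eq129CoshWeightFactorLetters (cosh_factor_step cosh_factor_pos weight_eq_factor_mul_transverse transverse_pos cosh_factor_centre_zero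
  cosh_factor_le_exp_mul_centre)
open B5Eq129FreeResolventWeightedGradientRow (weighted_sum_abs_sub_le_cosh weighted_sum_abs_sub_le_exp)
open B5Eq129FreeResolventCycleProfile (cycle_eq_of_resolvent_eq cycle_profile_eq root_const_eq exists_root closedForm_resolvent)
open B5Eq129FreeResolventCycleComparison (cycle_solution_nonneg)
open B5Eq129CycleWeightedMass (cosh_bracket_le_uniform exp_bracket_le_uniform)
open B5Eq129CycleKernelRootLetters (closedForm_apply_zero_le)

variable {d : ℕ} (N : Fin d → ℕ) [∀ μ, NeZero (N μ)]

/-- the transverse `cosh` product has the transverse supersolution defect `C = 2(d−1)t²(cosh a − 1)` — the binder `hCT` of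
`B5Eq129FreeResolventWeightedGradientRow.weighted_sum_abs_sub_le` (`prod_weight_transverse_defect` at `cosh_factor_step`, the constant rate summed out).
[folklore] [cite: Balaban1984PropagatorsI, p.36] -/
theorem transverse_cosh_defect (t a : ℝ) (ν : Fin d) (c x : Tor N) :
    -((2 * ((d : ℝ) - 1) * t ^ 2 * (Real.cosh a - 1)) *
        ∏ μ ∈ Finset.univ.erase ν, Real.cosh (a * (circAbs (N μ) ((c μ - x μ : ZMod (N μ)).val) : ℝ))) ≤
      ∑ μ ∈ Finset.univ.erase ν, t ^ 2 *
        (((∏ κ ∈ Finset.univ.erase ν, Real.cosh (a * (circAbs (N κ) ((c κ - x κ : ZMod (N κ)).val) : ℝ))) -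
            ∏ κ ∈ Finset.univ.erase ν, Real.cosh (a * (circAbs (N κ) ((c κ - (x - unitVec N μ) κ : ZMod (N κ)).val) : ℝ))) +
          ((∏ κ ∈ Finset.univ.erase ν, Real.cosh (a * (circAbs (N κ) ((c κ - x κ : ZMod (N κ)).val) : ℝ))) -
            ∏ κ ∈ Finset.univ.erase ν, Real.cosh (a * (circAbs (N κ) ((c κ - (x + unitVec N μ) κ : ZMod (N κ)).val) : ℝ)))) := by
  have h := prod_weight_transverse_defect N t ν (fun μ y => Real.cosh (a * (circAbs (N μ) ((c μ - y : ZMod (N μ)).val) : ℝ)))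
    (fun μ y => cosh_factor_pos a (c μ) y) (fun _ => a) (fun μ y => cosh_factor_step a (c μ) y) x
  have hcard : ((Finset.univ.erase ν).card : ℝ) = (d : ℝ) - 1 := by
    rw [Finset.card_erase_of_mem (Finset.mem_univ ν), Finset.card_univ, Fintype.card_fin,
      Nat.cast_sub (Nat.one_le_iff_ne_zero.mpr (by rintro rfl; exact Fin.elim0 ν)), Nat.cast_one]
  simp only [Finset.sum_const, nsmul_eq_mul, hcard] at h
  convert h using 2
  ring

/-- **THE WEIGHTED ∇-ROW IN THE OWNER's CURRENCY, EVERY CENTRE ((W-1′)).**  Let `(L₀ + m)k = δ₀` on `Π_μ ℤ∕N_μ` (weight `t²`, `m > 0`), fix `ν` with `N_ν ≥ 2`, a rate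
`a ≥ 0` in the window `2(d−1)t²(cosh a − 1) < m`, ANY centre `c`, and let `G` solve the cycle equation on `ℤ∕N_ν` at the shifted mass `m − 2(d−1)t²(cosh a − 1)`
(closed form: `B5Eq129FreeResolventCycleProfile.cycle_profile_eq`).  Then for the product weight `W_c(y) = Π_μ cosh(a·circAbs(N μ)((c μ − y μ).val))` of
`B5Eq129CoshSupersolution`:
`Σ_x W_c(x)·|k(x − e_ν) − k(x)| ≤ W_c(0)·[(1 + e^a)·G(0) + 2 sinh a·Σ_{1≤j<⌊N_ν∕2⌋} e^{a·j}·G(j)]`.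
Proof BY NAME: `W_c = (ν-factor)·Φ` (`weight_eq_factor_mul_transverse`); the ν-factor at `x` is `≤ e^{a·d(x_ν)}`·(its value at the source)
(`cosh_factor_le_exp_mul_centre`); (W-1) `weighted_sum_abs_sub_le_exp` for `Φ` (its three weight binders by `prod_weight_add_unitVec` ∕ `prod_weight_reflect` ∕
`transverse_cosh_defect`).  This is t4-ne9-idea-1 g129's `weighted_grad_row_le_torus_cosh_offslice` in the tree's (FS) encoding with unequal periods (there
normalised at the source; here multiplied out). [folklore] [cite: Balaban1984PropagatorsI, (1.29) p.23, p.36; Balaban1985BackgroundPropagators, Thm 3.1 (3.42) p.397] -/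
theorem sum_weight_mul_abs_sub_le (t : ℝ) {m a : ℝ} (hm : 0 < m) (ha : 0 ≤ a)
    (hCm : 2 * ((d : ℝ) - 1) * t ^ 2 * (Real.cosh a - 1) < m) {k : Tor N → ℝ}
    (hk : ∀ x, ∑ ν, t ^ 2 * ((k x - k (x - unitVec N ν)) + (k x - k (x + unitVec N ν))) + m * k x = if x = 0 then 1 else 0)
    (ν : Fin d) (hn : 2 ≤ N ν) (c : Tor N) {G : ZMod (N ν) → ℝ}
    (hG : ∀ s, t ^ 2 * ((G s - G (s - 1)) + (G s - G (s + 1))) + (m - 2 * ((d : ℝ) - 1) * t ^ 2 * (Real.cosh a - 1)) * G s =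
      if s = 0 then 1 else 0) :
    ∑ x : Tor N, (∏ μ, Real.cosh (a * (circAbs (N μ) ((c μ - x μ : ZMod (N μ)).val) : ℝ))) * |k (x - unitVec N ν) - k x| ≤
      (∏ μ, Real.cosh (a * (circAbs (N μ) ((c μ - (0 : Tor N) μ : ZMod (N μ)).val) : ℝ))) *
        ((1 + Real.exp a) * G 0 + 2 * Real.sinh a * ∑ j ∈ Finset.Ico 1 (N ν / 2), Real.exp (a * j) * G (j : ZMod (N ν))) := by
  classical
  -- the three weight binders of the transverse product `Φ`
  have hΦ0 : ∀ x : Tor N, 0 ≤ ∏ μ ∈ Finset.univ.erase ν, Real.cosh (a * (circAbs (N μ) ((c μ - x μ : ZMod (N μ)).val) : ℝ)) :=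
    fun x => (transverse_pos N a c x ν).le
  have hW1 := weighted_sum_abs_sub_le_exp N t hm hCm hk ν hn
    (Φ := fun x => ∏ μ ∈ Finset.univ.erase ν, Real.cosh (a * (circAbs (N μ) ((c μ - x μ : ZMod (N μ)).val) : ℝ))) hΦ0
    (fun x => prod_weight_add_unitVec N ν (fun μ y => Real.cosh (a * (circAbs (N μ) ((c μ - y : ZMod (N μ)).val) : ℝ))) x)
    (fun x => prod_weight_reflect N ν (fun μ y => Real.cosh (a * (circAbs (N μ) ((c μ - y : ZMod (N μ)).val) : ℝ))) x)
    (fun x => transverse_cosh_defect N t a ν c x) hG ha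
  -- the ν-factor, its value at the source, the factorisation
  set F : ZMod (N ν) → ℝ := fun s => Real.cosh (a * (circAbs (N ν) ((c ν - s : ZMod (N ν)).val) : ℝ)) with hF
  have hF0 : 0 ≤ F 0 := (Real.cosh_pos _).le
  have hfac : ∀ x : Tor N, ∏ μ, Real.cosh (a * (circAbs (N μ) ((c μ - x μ : ZMod (N μ)).val) : ℝ)) =
      F (x ν) * ∏ μ ∈ Finset.univ.erase ν, Real.cosh (a * (circAbs (N μ) ((c μ - x μ : ZMod (N μ)).val) : ℝ)) :=
    fun x => weight_eq_factor_mul_transverse N a c x ν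
  have hshift : ∀ x : Tor N, F (x ν) ≤ Real.exp (a * ((min (x ν).val (N ν - (x ν).val) : ℕ) : ℝ)) * F 0 :=
    fun x => cosh_factor_le_exp_mul_centre ha (c ν) (x ν)
  calc ∑ x : Tor N, (∏ μ, Real.cosh (a * (circAbs (N μ) ((c μ - x μ : ZMod (N μ)).val) : ℝ))) * |k (x - unitVec N ν) - k x|
      = ∑ x : Tor N, F (x ν) * (∏ μ ∈ Finset.univ.erase ν, Real.cosh (a * (circAbs (N μ) ((c μ - x μ : ZMod (N μ)).val) : ℝ))) *
          |k (x - unitVec N ν) - k x| := Finset.sum_congr rfl fun x _ => by rw [hfac x]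
    _ ≤ ∑ x : Tor N, (Real.exp (a * ((min (x ν).val (N ν - (x ν).val) : ℕ) : ℝ)) * F 0) *
          (∏ μ ∈ Finset.univ.erase ν, Real.cosh (a * (circAbs (N μ) ((c μ - x μ : ZMod (N μ)).val) : ℝ))) * |k (x - unitVec N ν) - k x| :=
        Finset.sum_le_sum fun x _ =>
          mul_le_mul_of_nonneg_right (mul_le_mul_of_nonneg_right (hshift x) (hΦ0 x)) (abs_nonneg _)
    _ = F 0 * ∑ x : Tor N, Real.exp (a * ((min (x ν).val (N ν - (x ν).val) : ℕ) : ℝ)) *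
          (∏ μ ∈ Finset.univ.erase ν, Real.cosh (a * (circAbs (N μ) ((c μ - x μ : ZMod (N μ)).val) : ℝ))) * |k (x - unitVec N ν) - k x| := by
        rw [Finset.mul_sum]
        exact Finset.sum_congr rfl fun x _ => by ring
    _ ≤ F 0 * ((∏ μ ∈ Finset.univ.erase ν, Real.cosh (a * (circAbs (N μ) ((c μ - (0 : Tor N) μ : ZMod (N μ)).val) : ℝ))) *
          ((1 + Real.exp a) * G 0 + 2 * Real.sinh a * ∑ j ∈ Finset.Ico 1 (N ν / 2), Real.exp (a * j) * G (j : ZMod (N ν)))) :=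
        mul_le_mul_of_nonneg_left hW1 hF0
    _ = (∏ μ, Real.cosh (a * (circAbs (N μ) ((c μ - (0 : Tor N) μ : ZMod (N μ)).val) : ℝ))) *
          ((1 + Real.exp a) * G 0 + 2 * Real.sinh a * ∑ j ∈ Finset.Ico 1 (N ν / 2), Real.exp (a * j) * G (j : ZMod (N ν))) := by
        rw [hfac 0]
        simp only [Pi.zero_apply, mul_assoc]

/-- **THE WEIGHTED ∇-ROW IN THE OWNER's CURRENCY, CENTRE ON THE SOURCE SLICE ((W-0)).**  As `sum_weight_mul_abs_sub_le`, for a centre with `c ν = 0`: the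
ν-factor `cosh(a·circAbs(N ν)((0 − x ν).val))` IS the longitudinal weight `cosh(a·min(x_ν, N_ν − x_ν))` (`cosh_factor_centre_zero`) and is `1` at the source, so
(W-0) `weighted_sum_abs_sub_le_cosh` reads
`Σ_x W_c(x)·|k(x − e_ν) − k(x)| ≤ W_c(0)·[(1 + cosh a)·G(0) + 2 sinh a·Σ_{1≤j<⌊N_ν∕2⌋} sinh(a·j)·G(j)]` — t4-ne9-idea-1 g129's `weighted_grad_row_le_torus_cosh`.
[folklore] [cite: Balaban1984PropagatorsI, (1.29) p.23, p.36; Balaban1985BackgroundPropagators, Thm 3.1 (3.42) p.397] -/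
theorem sum_weight_mul_abs_sub_le_of_centre_on_slice (t : ℝ) {m a : ℝ} (hm : 0 < m) (ha : 0 ≤ a)
    (hCm : 2 * ((d : ℝ) - 1) * t ^ 2 * (Real.cosh a - 1) < m) {k : Tor N → ℝ}
    (hk : ∀ x, ∑ ν, t ^ 2 * ((k x - k (x - unitVec N ν)) + (k x - k (x + unitVec N ν))) + m * k x = if x = 0 then 1 else 0)
    (ν : Fin d) (hn : 2 ≤ N ν) (c : Tor N) (hc : c ν = 0) {G : ZMod (N ν) → ℝ}
    (hG : ∀ s, t ^ 2 * ((G s - G (s - 1)) + (G s - G (s + 1))) + (m - 2 * ((d : ℝ) - 1) * t ^ 2 * (Real.cosh a - 1)) * G s =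
      if s = 0 then 1 else 0) :
    ∑ x : Tor N, (∏ μ, Real.cosh (a * (circAbs (N μ) ((c μ - x μ : ZMod (N μ)).val) : ℝ))) * |k (x - unitVec N ν) - k x| ≤
      (∏ μ, Real.cosh (a * (circAbs (N μ) ((c μ - (0 : Tor N) μ : ZMod (N μ)).val) : ℝ))) *
        ((1 + Real.cosh a) * G 0 + 2 * Real.sinh a * ∑ j ∈ Finset.Ico 1 (N ν / 2), Real.sinh (a * j) * G (j : ZMod (N ν))) := by
  classical
  have hΦ0 : ∀ x : Tor N, 0 ≤ ∏ μ ∈ Finset.univ.erase ν, Real.cosh (a * (circAbs (N μ) ((c μ - x μ : ZMod (N μ)).val) : ℝ)) :=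
    fun x => (transverse_pos N a c x ν).le
  have hW0 := weighted_sum_abs_sub_le_cosh N t hm hCm hk ν hn
    (Φ := fun x => ∏ μ ∈ Finset.univ.erase ν, Real.cosh (a * (circAbs (N μ) ((c μ - x μ : ZMod (N μ)).val) : ℝ))) hΦ0
    (fun x => prod_weight_add_unitVec N ν (fun μ y => Real.cosh (a * (circAbs (N μ) ((c μ - y : ZMod (N μ)).val) : ℝ))) x)
    (fun x => prod_weight_reflect N ν (fun μ y => Real.cosh (a * (circAbs (N μ) ((c μ - y : ZMod (N μ)).val) : ℝ))) x)
    (fun x => transverse_cosh_defect N t a ν c x) hG ha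
  have hfac : ∀ x : Tor N, ∏ μ, Real.cosh (a * (circAbs (N μ) ((c μ - x μ : ZMod (N μ)).val) : ℝ)) =
      Real.cosh (a * ((min (x ν).val (N ν - (x ν).val) : ℕ) : ℝ)) *
        ∏ μ ∈ Finset.univ.erase ν, Real.cosh (a * (circAbs (N μ) ((c μ - x μ : ZMod (N μ)).val) : ℝ)) := fun x => by
    rw [weight_eq_factor_mul_transverse N a c x ν, hc, cosh_factor_centre_zero]
  have h0 : Real.cosh (a * ((min ((0 : Tor N) ν).val (N ν - ((0 : Tor N) ν).val) : ℕ) : ℝ)) = 1 := by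
    rw [Pi.zero_apply, ZMod.val_zero, Nat.zero_min, Nat.cast_zero, mul_zero, Real.cosh_zero]
  calc ∑ x : Tor N, (∏ μ, Real.cosh (a * (circAbs (N μ) ((c μ - x μ : ZMod (N μ)).val) : ℝ))) * |k (x - unitVec N ν) - k x|
      = ∑ x : Tor N, Real.cosh (a * ((min (x ν).val (N ν - (x ν).val) : ℕ) : ℝ)) *
          (∏ μ ∈ Finset.univ.erase ν, Real.cosh (a * (circAbs (N μ) ((c μ - x μ : ZMod (N μ)).val) : ℝ))) * |k (x - unitVec N ν) - k x| :=
        Finset.sum_congr rfl fun x _ => by rw [hfac x]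
    _ ≤ _ := hW0
    _ = _ := by rw [hfac 0, h0, one_mul]

/-! ## §3 The brackets folded: the weighted ∇-row uniformly in the periods, in the OWNER's rate window -/

/-- a solution of the cycle equation with source `δ₀` is even (uniqueness, `B5Eq129FreeResolventCycleProfile.cycle_eq_of_resolvent_eq`). [folklore] -/
private theorem cycle_solution_even {n : ℕ} [NeZero n] (t : ℝ) {μ : ℝ} (hμ : 0 < μ) {G : ZMod n → ℝ}
    (hG : ∀ s, t ^ 2 * ((G s - G (s - 1)) + (G s - G (s + 1))) + μ * G s = if s = 0 then 1 else 0) (s : ZMod n) :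
    G (-s) = G s := by
  have h := cycle_eq_of_resolvent_eq t hμ (φ₁ := fun s => G (-s)) (φ₂ := G) (ψ := fun s => if s = 0 then (1 : ℝ) else 0)
    (fun s => by
      have e := hG (-s)
      simp only [neg_eq_zero] at e
      rw [← e, show -s - 1 = -(s + 1) by ring, show -s + 1 = -(s - 1) by ring]
      ring) hG
  exact congrFun h s

/-- **THE WEIGHTED ∇-ROW IN THE OWNER's CURRENCY, EVERY CENTRE, UNIFORMLY IN THE PERIODS.**  In the OWNER's rate window `2d·t²(cosh a − 1) < m`
(`λ = m − 2d·t²(cosh a − 1) > 0` of `B5Eq129CoshSupersolution.weight_supersolution`), with `G` the cycle kernel on `ℤ∕N_ν` at the transversally shifted mass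
`m − 2(d−1)t²(cosh a − 1)`:
`Σ_x W_c(x)·|k(x − e_ν) − k(x)| ≤ W_c(0)·[(1 + e^{−a})·G(0) + 2 sinh a ∕ λ]` — `sum_weight_mul_abs_sub_le` with its bracket folded by
`B5Eq129CycleWeightedMass.exp_bracket_le_uniform`.  Every letter on the right is height-free in the units `t = η⁻¹`, `a = κη`: `sinh a ≈ κη`, and `G(0) = (1 + qⁿ)∕((1 − qⁿ)√(μ² + 4μt²))`
(`B5Eq129FreeResolventCycleProfile.cycle_profile_eq`) is `O(η)` for periods `N_ν·η ≳ 1`. [folklore]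
[cite: Balaban1984PropagatorsI, (1.29) p.23, p.36; Balaban1985BackgroundPropagators, Thm 3.1 (3.42) p.397] -/
theorem sum_weight_mul_abs_sub_le_uniform (t : ℝ) {m a : ℝ} (hm : 0 < m) (ha : 0 ≤ a)
    (hlam : 2 * (d : ℝ) * t ^ 2 * (Real.cosh a - 1) < m) {k : Tor N → ℝ}
    (hk : ∀ x, ∑ ν, t ^ 2 * ((k x - k (x - unitVec N ν)) + (k x - k (x + unitVec N ν))) + m * k x = if x = 0 then 1 else 0)
    (ν : Fin d) (hn : 2 ≤ N ν) (c : Tor N) {G : ZMod (N ν) → ℝ}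
    (hG : ∀ s, t ^ 2 * ((G s - G (s - 1)) + (G s - G (s + 1))) + (m - 2 * ((d : ℝ) - 1) * t ^ 2 * (Real.cosh a - 1)) * G s =
      if s = 0 then 1 else 0) :
    ∑ x : Tor N, (∏ μ, Real.cosh (a * (circAbs (N μ) ((c μ - x μ : ZMod (N μ)).val) : ℝ))) * |k (x - unitVec N ν) - k x| ≤
      (∏ μ, Real.cosh (a * (circAbs (N μ) ((c μ - (0 : Tor N) μ : ZMod (N μ)).val) : ℝ))) *
        ((1 + Real.exp (-a)) * G 0 + 2 * Real.sinh a / (m - 2 * (d : ℝ) * t ^ 2 * (Real.cosh a - 1))) := by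
  have hct : 0 ≤ t ^ 2 * (Real.cosh a - 1) := mul_nonneg (sq_nonneg t) (by linarith [Real.one_le_cosh a])
  have hCm : 2 * ((d : ℝ) - 1) * t ^ 2 * (Real.cosh a - 1) < m := by nlinarith
  have hμ : 0 < m - 2 * ((d : ℝ) - 1) * t ^ 2 * (Real.cosh a - 1) := by linarith
  have hlam' : 2 * t ^ 2 * (Real.cosh a - 1) < m - 2 * ((d : ℝ) - 1) * t ^ 2 * (Real.cosh a - 1) := by nlinarith
  have hG0 : ∀ s, 0 ≤ G s := cycle_solution_nonneg t hμ hG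
  have hGeven : ∀ s, G (-s) = G s := cycle_solution_even t hμ hG
  have hB := exp_bracket_le_uniform t ha hlam' hG hG0 hGeven
  have e : m - 2 * ((d : ℝ) - 1) * t ^ 2 * (Real.cosh a - 1) - 2 * t ^ 2 * (Real.cosh a - 1) = m - 2 * (d : ℝ) * t ^ 2 * (Real.cosh a - 1) := by
    ring
  rw [e] at hB
  exact (sum_weight_mul_abs_sub_le N t hm ha hCm hk ν hn c hG).trans
    (mul_le_mul_of_nonneg_left hB (Finset.prod_nonneg fun _ _ => (Real.cosh_pos _).le))

/-- **THE SAME, CENTRE ON THE SOURCE SLICE** (`c ν = 0`): `Σ_x W_c(x)·|k(x − e_ν) − k(x)| ≤ W_c(0)·[(1 + e^{−a})·G(0) + sinh a ∕ λ]` —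
`sum_weight_mul_abs_sub_le_of_centre_on_slice` folded by `B5Eq129CycleWeightedMass.cosh_bracket_le_uniform`. [folklore]
[cite: Balaban1984PropagatorsI, (1.29) p.23, p.36; Balaban1985BackgroundPropagators, Thm 3.1 (3.42) p.397] -/
theorem sum_weight_mul_abs_sub_le_of_centre_on_slice_uniform (t : ℝ) {m a : ℝ} (hm : 0 < m) (ha : 0 ≤ a)
    (hlam : 2 * (d : ℝ) * t ^ 2 * (Real.cosh a - 1) < m) {k : Tor N → ℝ}
    (hk : ∀ x, ∑ ν, t ^ 2 * ((k x - k (x - unitVec N ν)) + (k x - k (x + unitVec N ν))) + m * k x = if x = 0 then 1 else 0)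
    (ν : Fin d) (hn : 2 ≤ N ν) (c : Tor N) (hc : c ν = 0) {G : ZMod (N ν) → ℝ}
    (hG : ∀ s, t ^ 2 * ((G s - G (s - 1)) + (G s - G (s + 1))) + (m - 2 * ((d : ℝ) - 1) * t ^ 2 * (Real.cosh a - 1)) * G s =
      if s = 0 then 1 else 0) :
    ∑ x : Tor N, (∏ μ, Real.cosh (a * (circAbs (N μ) ((c μ - x μ : ZMod (N μ)).val) : ℝ))) * |k (x - unitVec N ν) - k x| ≤
      (∏ μ, Real.cosh (a * (circAbs (N μ) ((c μ - (0 : Tor N) μ : ZMod (N μ)).val) : ℝ))) *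
        ((1 + Real.exp (-a)) * G 0 + Real.sinh a / (m - 2 * (d : ℝ) * t ^ 2 * (Real.cosh a - 1))) := by
  have hct : 0 ≤ t ^ 2 * (Real.cosh a - 1) := mul_nonneg (sq_nonneg t) (by linarith [Real.one_le_cosh a])
  have hCm : 2 * ((d : ℝ) - 1) * t ^ 2 * (Real.cosh a - 1) < m := by nlinarith
  have hμ : 0 < m - 2 * ((d : ℝ) - 1) * t ^ 2 * (Real.cosh a - 1) := by linarith
  have hlam' : 2 * t ^ 2 * (Real.cosh a - 1) < m - 2 * ((d : ℝ) - 1) * t ^ 2 * (Real.cosh a - 1) := by nlinarith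
  have hG0 : ∀ s, 0 ≤ G s := cycle_solution_nonneg t hμ hG
  have hGeven : ∀ s, G (-s) = G s := cycle_solution_even t hμ hG
  have hB := cosh_bracket_le_uniform t ha hlam' hG hG0 hGeven
  have e : m - 2 * ((d : ℝ) - 1) * t ^ 2 * (Real.cosh a - 1) - 2 * t ^ 2 * (Real.cosh a - 1) = m - 2 * (d : ℝ) * t ^ 2 * (Real.cosh a - 1) := by
    ring
  rw [e] at hB
  exact (sum_weight_mul_abs_sub_le_of_centre_on_slice N t hm ha hCm hk ν hn c hc hG).trans
    (mul_le_mul_of_nonneg_left hB (Finset.prod_nonneg fun _ _ => (Real.cosh_pos _).le))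

/-! ## §4 The one kernel letter `G(0)` in closed form; the weighted ∇-row with no kernel letter left -/

/-- **`G(0)` IN CLOSED FORM**: for the cycle kernel at mass `μ > 0` on `ℤ∕n` (`n ≥ 2`, `t ≠ 0`) and the small root `q ∈ (0,1)` of `q + q⁻¹ = 2 + μ∕t²`:
`G(0) = (1 + qⁿ)∕((1 − qⁿ)·√(μ² + 4μt²))` — `B5Eq129FreeResolventCycleProfile.cycle_profile_eq` at `s = 0` with `root_const_eq` (`2q∕(t²(1 − q²)) = 2∕√(μ² + 4μt²)`).
In the units `t = η⁻¹`: `1∕√(μ² + 4μt²) = η∕√(4μ + μ²η²)` — the height-free size of the letter. [folklore] [cite: Balaban1984PropagatorsI, (1.29) p.23] -/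
theorem cycle_apply_zero_eq {n : ℕ} [NeZero n] (hn : 2 ≤ n) (t : ℝ) (ht : t ≠ 0) {μ : ℝ} (hμ : 0 < μ) {q : ℝ} (hq0 : 0 < q) (hq1 : q < 1)
    (hq : q + q⁻¹ = 2 + μ / t ^ 2) {G : ZMod n → ℝ}
    (hG : ∀ s, t ^ 2 * ((G s - G (s - 1)) + (G s - G (s + 1))) + μ * G s = if s = 0 then 1 else 0) :
    G 0 = (1 + q ^ n) / ((1 - q ^ n) * Real.sqrt (μ ^ 2 + 4 * μ * t ^ 2)) := by
  have h0 := cycle_profile_eq hn t ht hμ hq0 hq1 hq hG 0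
  have hr := root_const_eq t ht hμ hq0 hq1 hq
  have hq2 : 0 < 1 - q ^ 2 := by nlinarith
  have hqn : 0 < 1 - q ^ n := by
    have := pow_lt_one₀ hq0.le hq1 (by omega : n ≠ 0)
    linarith
  have ht2 : 0 < t ^ 2 := by positivity
  have hD : 0 < Real.sqrt (μ ^ 2 + 4 * μ * t ^ 2) := Real.sqrt_pos.mpr (by positivity)
  have hr' : q / (t ^ 2 * (1 - q ^ 2)) = 1 / Real.sqrt (μ ^ 2 + 4 * μ * t ^ 2) := by
    have e : q / (t ^ 2 * (1 - q ^ 2)) = (2 * q / (t ^ 2 * (1 - q ^ 2))) / 2 := by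
      field_simp
    rw [e, hr]
    field_simp
  rw [h0, ZMod.val_zero, pow_zero, Nat.sub_zero]
  have e2 : q / (t ^ 2 * (1 - q ^ 2) * (1 - q ^ n)) * (1 + q ^ n) = q / (t ^ 2 * (1 - q ^ 2)) * ((1 + q ^ n) / (1 - q ^ n)) := by
    field_simp
  rw [e2, hr']
  field_simp

/-- **THE WEIGHTED ∇-ROW WITH NO KERNEL LETTER LEFT** (every centre, every period `N_ν ≥ 2`): in the OWNER's rate window, with `μ = m − 2(d−1)t²(cosh a − 1)` the
transversally shifted mass, `q ∈ (0,1)` its small root (`q + q⁻¹ = 2 + μ∕t²`, `B5Eq129FreeResolventCycleProfile.exists_root`) and `λ = m − 2d·t²(cosh a − 1)`: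
`Σ_x W_c(x)·|k(x − e_ν) − k(x)| ≤ W_c(0)·[(1 + e^{−a})·(1 + q^{N_ν})∕((1 − q^{N_ν})·√(μ² + 4μt²)) + 2 sinh a ∕ λ]` — `sum_weight_mul_abs_sub_le_uniform` with
`cycle_apply_zero_eq` substituted (the cycle solution `G` exists: `B5Eq129FreeResolventCycleProfile.closedForm_resolvent`; here it is still taken as the binder `hG`
so that nothing is chosen inside the proof). [folklore] [cite: Balaban1984PropagatorsI, (1.29) p.23, p.36; Balaban1985BackgroundPropagators, Thm 3.1 (3.42) p.397] -/
theorem sum_weight_mul_abs_sub_le_closedForm (t : ℝ) (ht : t ≠ 0) {m a : ℝ} (hm : 0 < m) (ha : 0 ≤ a)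
    (hlam : 2 * (d : ℝ) * t ^ 2 * (Real.cosh a - 1) < m) {k : Tor N → ℝ}
    (hk : ∀ x, ∑ ν, t ^ 2 * ((k x - k (x - unitVec N ν)) + (k x - k (x + unitVec N ν))) + m * k x = if x = 0 then 1 else 0)
    (ν : Fin d) (hn : 2 ≤ N ν) (c : Tor N) {q : ℝ} (hq0 : 0 < q) (hq1 : q < 1)
    (hq : q + q⁻¹ = 2 + (m - 2 * ((d : ℝ) - 1) * t ^ 2 * (Real.cosh a - 1)) / t ^ 2) {G : ZMod (N ν) → ℝ}
    (hG : ∀ s, t ^ 2 * ((G s - G (s - 1)) + (G s - G (s + 1))) + (m - 2 * ((d : ℝ) - 1) * t ^ 2 * (Real.cosh a - 1)) * G s =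
      if s = 0 then 1 else 0) :
    ∑ x : Tor N, (∏ μ, Real.cosh (a * (circAbs (N μ) ((c μ - x μ : ZMod (N μ)).val) : ℝ))) * |k (x - unitVec N ν) - k x| ≤
      (∏ μ, Real.cosh (a * (circAbs (N μ) ((c μ - (0 : Tor N) μ : ZMod (N μ)).val) : ℝ))) *
        ((1 + Real.exp (-a)) * ((1 + q ^ N ν) / ((1 - q ^ N ν) *
            Real.sqrt ((m - 2 * ((d : ℝ) - 1) * t ^ 2 * (Real.cosh a - 1)) ^ 2 + 4 * (m - 2 * ((d : ℝ) - 1) * t ^ 2 * (Real.cosh a - 1)) * t ^ 2))) +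
          2 * Real.sinh a / (m - 2 * (d : ℝ) * t ^ 2 * (Real.cosh a - 1))) := by
  have hct : 0 ≤ t ^ 2 * (Real.cosh a - 1) := mul_nonneg (sq_nonneg t) (by linarith [Real.one_le_cosh a])
  have hμ : 0 < m - 2 * ((d : ℝ) - 1) * t ^ 2 * (Real.cosh a - 1) := by nlinarith
  have h := sum_weight_mul_abs_sub_le_uniform N t hm ha hlam hk ν hn c hG
  rwa [cycle_apply_zero_eq hn t ht hμ hq0 hq1 hq hG] at h

/-- **`G(0)` WITHOUT `q`, PERIOD-EXPLICIT**: for the cycle kernel at mass `μ > 0` on `ℤ∕n` (`n ≥ 2`, `t > 0`):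
`G(0) ≤ (1 + 2t∕(n·√μ))∕√(μ² + 4μt²)` — `cycle_apply_zero_eq` with `B5Eq129CycleKernelRootLetters.closedForm_apply_zero_le` (`(1 + qⁿ)∕(1 − qⁿ) ≤ 1 + 2q∕(n(1 − q))`,
`q∕(1 − q) ≤ t∕√μ`).  In the units
`t = η⁻¹`: `G(0) ≤ (1 + 2∕(L√μ))·η∕√(4μ + μ²η²)`, `L = nη` the physical period. [folklore] [cite: Balaban1984PropagatorsI, (1.29) p.23] -/
theorem cycle_apply_zero_le {n : ℕ} [NeZero n] (hn : 2 ≤ n) (t : ℝ) (ht : 0 < t) {μ : ℝ} (hμ : 0 < μ) {q : ℝ} (hq0 : 0 < q) (hq1 : q < 1)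
    (hq : q + q⁻¹ = 2 + μ / t ^ 2) {G : ZMod n → ℝ}
    (hG : ∀ s, t ^ 2 * ((G s - G (s - 1)) + (G s - G (s + 1))) + μ * G s = if s = 0 then 1 else 0) :
    G 0 ≤ (1 + 2 * t / (n * Real.sqrt μ)) / Real.sqrt (μ ^ 2 + 4 * μ * t ^ 2) := by
  rw [cycle_apply_zero_eq hn t ht.ne' hμ hq0 hq1 hq hG]
  exact closedForm_apply_zero_le t ht hμ hq0 hq1 hq (by omega)

/-- **THE WEIGHTED ∇-ROW, FULLY EXPLICIT** (every centre, every period `N_ν ≥ 2`; neither `G` nor `q` on either side): in the OWNER's rate window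
`2d·t²(cosh a − 1) < m`, `t > 0`, `a ≥ 0`, with `μ = m − 2(d−1)t²(cosh a − 1)` and `λ = m − 2d·t²(cosh a − 1)` written out,
`Σ_x W_c(x)·|k(x − e_ν) − k(x)| ≤ W_c(0)·[(1 + e^{−a})·(1 + 2t∕(N_ν√μ))∕√(μ² + 4μt²) + 2 sinh a ∕ λ]` — `sum_weight_mul_abs_sub_le_uniform` at the cycle kernel
(`B5Eq129FreeResolventCycleProfile.exists_root` ∕ `closedForm_resolvent` inhabit `q` and `G` inside the proof) and `cycle_apply_zero_le`.  In the units `t = η⁻¹`,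
`a = κη`: `η⁻¹·[…] = (1 + e^{−κη})(1 + 2∕(L_ν√μ))∕√(4μ + μ²η²) + 2η⁻¹sinh(κη)∕λ` — height-free (`L_ν = N_νη`). [folklore]
[cite: Balaban1984PropagatorsI, (1.29) p.23, p.36; Balaban1985BackgroundPropagators, Thm 3.1 (3.42) p.397] -/
theorem sum_weight_mul_abs_sub_le_explicit (t : ℝ) (ht : 0 < t) {m a : ℝ} (hm : 0 < m) (ha : 0 ≤ a)
    (hlam : 2 * (d : ℝ) * t ^ 2 * (Real.cosh a - 1) < m) {k : Tor N → ℝ}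
    (hk : ∀ x, ∑ ν, t ^ 2 * ((k x - k (x - unitVec N ν)) + (k x - k (x + unitVec N ν))) + m * k x = if x = 0 then 1 else 0)
    (ν : Fin d) (hn : 2 ≤ N ν) (c : Tor N) :
    ∑ x : Tor N, (∏ μ, Real.cosh (a * (circAbs (N μ) ((c μ - x μ : ZMod (N μ)).val) : ℝ))) * |k (x - unitVec N ν) - k x| ≤
      (∏ μ, Real.cosh (a * (circAbs (N μ) ((c μ - (0 : Tor N) μ : ZMod (N μ)).val) : ℝ))) *
        ((1 + Real.exp (-a)) * ((1 + 2 * t / (N ν * Real.sqrt (m - 2 * ((d : ℝ) - 1) * t ^ 2 * (Real.cosh a - 1)))) /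
            Real.sqrt ((m - 2 * ((d : ℝ) - 1) * t ^ 2 * (Real.cosh a - 1)) ^ 2 + 4 * (m - 2 * ((d : ℝ) - 1) * t ^ 2 * (Real.cosh a - 1)) * t ^ 2)) +
          2 * Real.sinh a / (m - 2 * (d : ℝ) * t ^ 2 * (Real.cosh a - 1))) := by
  have hct : 0 ≤ t ^ 2 * (Real.cosh a - 1) := mul_nonneg (sq_nonneg t) (by linarith [Real.one_le_cosh a])
  have hμ : 0 < m - 2 * ((d : ℝ) - 1) * t ^ 2 * (Real.cosh a - 1) := by nlinarith
  obtain ⟨q, hq0, hq1, hq⟩ := exists_root t ht.ne' hμ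
  have hG := closedForm_resolvent hn t ht.ne' (m - 2 * ((d : ℝ) - 1) * t ^ 2 * (Real.cosh a - 1)) hq0 hq1 hq
  have h := sum_weight_mul_abs_sub_le_uniform N t hm ha hlam hk ν hn c hG
  have hG0 := cycle_apply_zero_le hn t ht hμ hq0 hq1 hq hG
  refine h.trans (mul_le_mul_of_nonneg_left ?_ (Finset.prod_nonneg fun _ _ => (Real.cosh_pos _).le))
  have hea : 0 ≤ 1 + Real.exp (-a) := by positivity
  simp only [ZMod.val_zero, pow_zero, Nat.sub_zero] at hG0 ⊢
  linarith [mul_le_mul_of_nonneg_left hG0 hea]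

/-- **THE WEIGHTED ∇-ROW, FULLY EXPLICIT, CENTRE ON THE SOURCE SLICE** (`c ν = 0`; every period `N_ν ≥ 2`): as `sum_weight_mul_abs_sub_le_explicit` with the
sharper `sinh a ∕ λ`: `Σ_x W_c(x)·|k(x − e_ν) − k(x)| ≤ W_c(0)·[(1 + e^{−a})·(1 + 2t∕(N_ν√μ))∕√(μ² + 4μt²) + sinh a ∕ λ]` — the case of a weight centred at the
output site of the Green's function (`B5Eq129FreeResolventWeightedGradientRowOperator`: centre `x − c = 0`). [folklore]
[cite: Balaban1984PropagatorsI, (1.29) p.23, p.36; Balaban1985BackgroundPropagators, Thm 3.1 (3.42) p.397] -/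
theorem sum_weight_mul_abs_sub_le_of_centre_on_slice_explicit (t : ℝ) (ht : 0 < t) {m a : ℝ} (hm : 0 < m) (ha : 0 ≤ a)
    (hlam : 2 * (d : ℝ) * t ^ 2 * (Real.cosh a - 1) < m) {k : Tor N → ℝ}
    (hk : ∀ x, ∑ ν, t ^ 2 * ((k x - k (x - unitVec N ν)) + (k x - k (x + unitVec N ν))) + m * k x = if x = 0 then 1 else 0)
    (ν : Fin d) (hn : 2 ≤ N ν) (c : Tor N) (hc : c ν = 0) :
    ∑ x : Tor N, (∏ μ, Real.cosh (a * (circAbs (N μ) ((c μ - x μ : ZMod (N μ)).val) : ℝ))) * |k (x - unitVec N ν) - k x| ≤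
      (∏ μ, Real.cosh (a * (circAbs (N μ) ((c μ - (0 : Tor N) μ : ZMod (N μ)).val) : ℝ))) *
        ((1 + Real.exp (-a)) * ((1 + 2 * t / (N ν * Real.sqrt (m - 2 * ((d : ℝ) - 1) * t ^ 2 * (Real.cosh a - 1)))) /
            Real.sqrt ((m - 2 * ((d : ℝ) - 1) * t ^ 2 * (Real.cosh a - 1)) ^ 2 + 4 * (m - 2 * ((d : ℝ) - 1) * t ^ 2 * (Real.cosh a - 1)) * t ^ 2)) +
          Real.sinh a / (m - 2 * (d : ℝ) * t ^ 2 * (Real.cosh a - 1))) := by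
  have hct : 0 ≤ t ^ 2 * (Real.cosh a - 1) := mul_nonneg (sq_nonneg t) (by linarith [Real.one_le_cosh a])
  have hμ : 0 < m - 2 * ((d : ℝ) - 1) * t ^ 2 * (Real.cosh a - 1) := by nlinarith
  obtain ⟨q, hq0, hq1, hq⟩ := exists_root t ht.ne' hμ
  have hG := closedForm_resolvent hn t ht.ne' (m - 2 * ((d : ℝ) - 1) * t ^ 2 * (Real.cosh a - 1)) hq0 hq1 hq
  have h := sum_weight_mul_abs_sub_le_of_centre_on_slice_uniform N t hm ha hlam hk ν hn c hc hG
  have hG0 := cycle_apply_zero_le hn t ht hμ hq0 hq1 hq hG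
  refine h.trans (mul_le_mul_of_nonneg_left ?_ (Finset.prod_nonneg fun _ _ => (Real.cosh_pos _).le))
  have hea : 0 ≤ 1 + Real.exp (-a) := by positivity
  simp only [ZMod.val_zero, pow_zero, Nat.sub_zero] at hG0 ⊢
  linarith [mul_le_mul_of_nonneg_left hG0 hea]

end Literature.MathematicalPhysics.QuantumFieldTheory.Balaban1983to89.B5Eq129FreeResolventWeightedGradientRowCosh

end
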